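import Literature.AlgebraicGeometry.Motives.TateAbelianFiniteAssemblyProofs
import Literature.AlgebraicGeometry.Motives.AbelianVarietyEndAlgebraSemisimpleProofs
import Literature.NumberTheory.DiophantineGeometry.AVIsogenyTateInjectiveProofs
import HarnessLib

/-!
# Tate 1966, Main Theorem (`Hom` form): the residual inputs in their printed form

Third sibling (theorems only) of `Literature.AlgebraicGeometry.Motives.TateAbelianFinite`, after
`TateAbelianFiniteProofs` and `TateAbelianFiniteAssemblyProofs`. Those files reduce the named fact
`Literature.AlgebraicGeometry.Motives.tate_bijective_of_finite A B ℓ` (J. Tate, *Endomorphisms of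
abelian varieties over finite fields*, Invent. Math. 2 (1966), Main Theorem: for `K` finite and
`ℓ ≠ char K` the Tate map `ℤ_ℓ ⊗ Hom_K(A, B) → Hom_{Γ_K}(T_ℓ A, T_ℓ B)` is bijective) to five
inputs (`tate_bijective_of_finite_of_open_facts_of_divisible`, `…_open_facts_bicone`): injectivity
of the Tate map, finiteness of `K`-isomorphism classes, quotients by finite stable subgroups, and
two hypotheses that were *not* in the form the sources print them:

* `hss : IsSemisimpleRing (rationalEndSubalgebra P ℓ)` — semisimplicity of the `ℚ_ℓ`-algebra
  `E_ℓ(P) ⊆ End_{ℚ_ℓ}(V_ℓ P)` spanned by the `V_ℓ φ`, `φ ∈ End_K(P)`, `P = A × B`;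
* `hdiv` — a homomorphism `φ : A → B` killing `A[ℓ](K̄)` is divisible by `ℓ` in `Hom_K(A, B)`.

Since then the tree has acquired, as theorems:

* Milne 1986, Lemma 12.6 (`AbelianVariety.exists_eq_nsmul_of_forall_geomTorsion`,
  `AVIsogenyTateInjectiveProofs`): a homomorphism killing `A[m](K̄)`, `m` invertible in `K`, is
  divisible by `m` — this *is* `hdiv` (`AbelianVariety.exists_eq_nsmul_of_forall_smul_eq_zero`
  below repackages the torsion condition);
* the passage from the printed Poincaré corollary "`End⁰(P) = ℚ ⊗ End_K(P)` is a
  (finite-dimensional) semisimple `ℚ`-algebra" (Mumford, *Abelian Varieties*, §19, Cor. 2 of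
  Thm. 1, p. 174) to the semisimplicity of the `ℚ_ℓ`-subalgebra of `End(V_ℓ P)` generated by the
  `V_ℓ φ` (`isSemisimpleRing_adjoin_rationalTateModuleMap_of_endAlgebra`,
  `FaltingsAbelianEndAlgebraProofs`: base change of semisimplicity along `ℚ → ℚ_ℓ` and a
  surjection), and the proof of that corollary from Poincaré's complete reducibility theorem
  itself (`AbelianVariety.isSemisimpleRing_endAlgebra_of_isogeny_biprod`,
  `…_of_mumford19`, `AbelianVarietyEndAlgebraSemisimpleProofs`);
* Mumford §19 Thm. 3 reduced to finite generation of `Hom` (`faltingsTateMap_injective_of_module_finite_hom`,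
  `finiteDimensional_endAlgebra_of_module_finite_hom`) and finite generation reduced to Mumford's
  §19 statements (`module_finite_hom_of_mumford19`, `AVIsogenyTateHomPoincareProofs`).

This file threads these through the `Hom`-form assembly, so that the `Hom` form of Tate's theorem
rests on exactly the same residual inputs as the `End` form
(`tate_end_bijective_of_finite_of_endAlgebra`, `…_of_poincare`, `…_of_mumford19`), but placed at
`A × B` rather than at `(A × B) × (A × B)` (the `End`-form route to the `Hom` form,
`tate_bijective_of_finite_of_end_biprod`, doubles the product once more):

1. `AbelianVariety.rationalEndSubalgebra_eq_adjoin`: the two spellings of `E_ℓ(P)` in the tree —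
   the subalgebra `rationalEndSubalgebra P ℓ` with carrier the span `rationalEndSpanAV P ℓ`
   (`TateAbelianFiniteProofs`) and `Algebra.adjoin ℚ_[ℓ] (range V_ℓ)` (`TateAbelianFiniteEndProofs`,
   `FaltingsAbelian*Proofs`) — are equal (`mem_adjoin_iff_mem_rationalEndSpanAV`); hence
   `AbelianVariety.isSemisimpleRing_rationalEndSubalgebra_of_endAlgebra`: `E_ℓ(P)` is semisimple if
   `End⁰(P)` is finite-dimensional and semisimple.
2. `AbelianVariety.exists_eq_nsmul_of_forall_smul_eq_zero`: `hdiv` from Milne's Lemma 12.6.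
3. `AbelianVariety.module_finite_end_biprod_of_corners`: `End_K(A × B)` is finitely generated if
   the four groups `Hom_K(X, Y)`, `X, Y ∈ {A, B}`, are (the corner map
   `e ↦ (in_X ≫ e ≫ pr_Y)` is an injective `ℤ`-linear map; Milne 1986, proof of Thm. 12.5,
   "`Hom(A, B)` is a direct summand of `End(A × B)`", conversely to
   `module_finite_hom_of_module_finite_end_biprod`).
4. The assemblies: `tate_bijective_of_finite_of_endAlgebra_bicone` / `…_of_endAlgebra` (inputs:
   `faltingsTateMap_injective A B`, `finite_isoClasses_of_finite K (dim (A × B))`,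
   `exists_quotient_isogeny (A × B) ℓ`, `finiteDimensional_endAlgebra (A × B)`,
   `IsSemisimpleRing (endAlgebra (A × B))`); `…_of_endAlgebra_of_module_finite_hom` (the two
   Mumford §19 Thm. 3 inputs from `module_finite_hom (A × B) (A × B)`);
   `…_of_poincare` (Poincaré's theorem `hP`, `hsimple` in place of semisimplicity);
   `…_of_mumford19` (everything of Mumford §19 as consumed by `module_finite_hom_of_mumford19`:
   `[n]_X` an isogeny, Poincaré's complete reducibility `hP1`, `hsimple`, the degree theorem
   `hdeg`, and the torsion counts of `A` and `B`).

So after this file the discharge `tate_bijective_of_finite_holds` is the one-liner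
`tate_bijective_of_finite_of_endAlgebra A B ℓ ‹Mumford §19 Thm. 3› ‹Milne 1986 Cor. 18.9›
‹quotients› ‹dim End⁰ < ∞› ‹Poincaré›`, pending the discharges of the named facts
`faltingsTateMap_injective` / `module_finite_hom`, `finite_isoClasses_of_finite`,
`exists_quotient_isogeny`, `finiteDimensional_endAlgebra` and a proof of Poincaré's complete
reducibility theorem (which enters the tree only as the raw hypotheses `hP`/`hP1`, `hsimple`).

No definition, no named fact, no `_holds` (D-0026).

## References

* [Tate1966Endomorphisms] J. Tate, *Endomorphisms of abelian varieties over finite fields*,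
  Invent. Math. 2 (1966), 134–144, Main Theorem; §1 Lemma 1. Not held (doi:10.1007/bf01404549).
* [Milne1986AbelianVarieties] J. S. Milne, *Abelian Varieties*, in Cornell–Silverman (eds.),
  *Arithmetic Geometry* (1986): Thm. 12.5 and its proof, Lemma 12.6 (PDF pp. 190–192 of the held
  copy `book:cornellnd-arithmetic-geometry`), §12 p. 122 (`End⁰(A)` semisimple), Cor. 18.9.
* [MumfordAV1970] D. Mumford, *Abelian Varieties*, §19: Thm. 1 (Poincaré), Cor. 2 p. 174, Thm. 3.
  Not held.
* [Kieffer2024IsogenyGraphs] J. Kieffer, *Isogeny graphs of abelian varieties over finite fields*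
  (2024), §1.2.4, Prop. 1.2.20–1.2.26 (architecture of the `Hom` form); held, read.

## Design

Theorems only; universe-monomorphic `K : Type u`; hypotheses spelled exactly as in
`AbelianVarietyEndAlgebraSemisimpleProofs` / `AVIsogenyTateHomPoincareProofs` (so that the same
terms feed both the `End` and the `Hom` assemblies). The biproduct is Mathlib's `A ⊞ B` from the
instance `HasBinaryBiproducts (AbelianVariety K)` (`AbelianVarietyProduct`), a `BinaryBicone`, so the
bicone-level assembly `tate_bijective_of_finite_of_open_facts_bicone` applies to it verbatim.
Mathlib used: `Subalgebra.ext`, `AddSubgroup.torsionBy.nsmul_iff`, `natCast_zsmul`,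
`Module.Finite.of_injective`, `biprod.hom_ext`, `biprod.hom_ext'`.
-/

universe u

open CategoryTheory CategoryTheory.Limits AlgebraicGeometry

namespace Literature.AlgebraicGeometry.Motives

namespace AbelianVariety

variable {K : Type u} [Field K] (P : AbelianVariety K) (ℓ : ℕ) [Fact ℓ.Prime]

/-! ## `E_ℓ(P)`: the two spellings agree; semisimplicity from `End⁰(P)` -/

/-- **The two spellings of `E_ℓ(P)` agree.** The `ℚ_ℓ`-subalgebra `rationalEndSubalgebra P ℓ` of
`End_{ℚ_ℓ}(V_ℓ P)` (carrier: the `ℚ_ℓ`-span `rationalEndSpanAV P ℓ` of the `V_ℓ φ`,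
`φ ∈ End_K(P)`; `TateAbelianFiniteProofs`) is the subalgebra generated by the `V_ℓ φ`
(`TateAbelianFiniteEndProofs.mem_adjoin_iff_mem_rationalEndSpanAV`: the generators are a
multiplicative family containing `1`). Both are Tate's `E ⊗ ℚ_ℓ ↪ End V_ℓ(A)` (Tate 1966, §1)
and Kieffer's `V_ℓ(End(A) ⊗ ℚ_ℓ)` (2024, §1.2.4). [folklore] -/
theorem rationalEndSubalgebra_eq_adjoin :
    rationalEndSubalgebra P ℓ = Algebra.adjoin ℚ_[ℓ] (Set.range fun φ : P ⟶ P ↦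
      (rationalTateModuleMap ℓ φ : Module.End ℚ_[ℓ] (P.rationalTateModule ℓ))) :=
  Subalgebra.ext fun x ↦
    (mem_rationalEndSubalgebra_iff P ℓ x).trans (mem_adjoin_iff_mem_rationalEndSpanAV ℓ x).symm

/-- **`E_ℓ(P)` is semisimple if `End⁰(P)` is finite-dimensional and semisimple** — the
hypothesis `hss` of `tate_bijective_of_finite_of_open_facts` from its printed source (Mumford §19,
Cor. 2 of Thm. 1, p. 174: `End⁰(X)` is semisimple; Milne, *Abelian Varieties* (2008), Ch. IV,
proof of Thm. 2.5: "because `E := End(A) ⊗ ℚ` is semisimple, so is `E ⊗_ℚ ℚ_ℓ`", and `E_ℓ(P)` is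
a quotient of the latter). This is `isSemisimpleRing_adjoin_rationalTateModuleMap_of_endAlgebra`
(`FaltingsAbelianEndAlgebraProofs`) transported along `rationalEndSubalgebra_eq_adjoin`.
[cite: MumfordAV1970, §19 Cor. 2 of Thm. 1 (p. 174)] -/
theorem isSemisimpleRing_rationalEndSubalgebra_of_endAlgebra (hfd : finiteDimensional_endAlgebra P)
    (hss : IsSemisimpleRing (endAlgebra P)) : IsSemisimpleRing (rationalEndSubalgebra P ℓ) := by
  rw [rationalEndSubalgebra_eq_adjoin]
  exact isSemisimpleRing_adjoin_rationalTateModuleMap_of_endAlgebra P ℓ hfd hss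

/-! ## Divisibility by `ℓ` of homomorphisms killing `A[ℓ](K̄)` (Milne 1986, Lemma 12.6) -/

omit [Fact ℓ.Prime] in
/-- **A homomorphism killing `A[ℓ](K̄)` is divisible by `ℓ`**, for `ℓ` invertible in `K` — the
hypothesis `hdiv` of `tate_bijective_of_finite_of_open_facts_of_divisible`, i.e. the isogeny
factorisation through the separable isogeny `[ℓ]_A` (Kieffer 2024, Prop. 1.1.12; Tate 1966, §1,
proof of Lemma 1). It is Milne 1986, Lemma 12.6 with `n = 1`, a theorem of the tree
(`exists_eq_nsmul_of_forall_geomTorsion`, `AVIsogenyTateInjectiveProofs`: `[ℓ]_A` is finite étale,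
so `Ker [ℓ] ⊆ Ker φ` can be tested on `K̄`-points, and `[ℓ]_A` is the quotient by its kernel),
with the torsion condition `x ∈ A(K̄)[ℓ]` spelled `ℓ • x = 0` (`AddSubgroup.torsionBy.nsmul_iff`).
[cite: Milne1986AbelianVarieties, Lemma 12.6 (PDF p. 191)] -/
theorem exists_eq_nsmul_of_forall_smul_eq_zero {A B : AbelianVariety K} (hℓ : (ℓ : K) ≠ 0)
    (φ : A ⟶ B) (hφ : ∀ x : A.geomPoints, ℓ • x = 0 → Hom.geomPointsMap φ x = 0) :
    ∃ ψ : A ⟶ B, φ = ℓ • ψ := by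
  obtain ⟨ψ, hψ⟩ := exists_eq_nsmul_of_forall_geomTorsion ℓ hℓ φ fun x hx ↦
    hφ x (AddSubgroup.torsionBy.nsmul_iff.mp hx)
  exact ⟨ψ, by rw [hψ, natCast_zsmul]⟩

/-! ## `End_K(A × B)` is finitely generated if the four `Hom_K(X, Y)` are -/

/-- **`End_K(A ⊞ B)` is finitely generated as soon as the four corners `Hom_K(A, A)`,
`Hom_K(A, B)`, `Hom_K(B, A)`, `Hom_K(B, B)` are** (Milne 1986, proof of Thm. 12.5: `Hom(A, B)`
is a direct summand of `End(A × B)`; here the converse bookkeeping): the corner map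
`e ↦ (in₁ e pr₁, in₁ e pr₂, in₂ e pr₁, in₂ e pr₂)` is `ℤ`-linear and injective
(`biprod.hom_ext`, `biprod.hom_ext'`), and `ℤ` is noetherian (`Module.Finite.of_injective`).
[cite: Milne1986AbelianVarieties, Thm. 12.5 (proof, PDF p. 191)] -/
theorem module_finite_end_biprod_of_corners {A B : AbelianVariety K}
    (hAA : Module.Finite ℤ (A ⟶ A)) (hAB : Module.Finite ℤ (A ⟶ B))
    (hBA : Module.Finite ℤ (B ⟶ A)) (hBB : Module.Finite ℤ (B ⟶ B)) :
    Module.Finite ℤ (A ⊞ B ⟶ A ⊞ B) := by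
  let c : (A ⊞ B ⟶ A ⊞ B) →ₗ[ℤ] ((A ⟶ A) × (A ⟶ B)) × ((B ⟶ A) × (B ⟶ B)) :=
    { toFun := fun e ↦
        (((biprod.inl : A ⟶ A ⊞ B) ≫ e ≫ (biprod.fst : A ⊞ B ⟶ A),
          (biprod.inl : A ⟶ A ⊞ B) ≫ e ≫ (biprod.snd : A ⊞ B ⟶ B)),
         ((biprod.inr : B ⟶ A ⊞ B) ≫ e ≫ (biprod.fst : A ⊞ B ⟶ A),
          (biprod.inr : B ⟶ A ⊞ B) ≫ e ≫ (biprod.snd : A ⊞ B ⟶ B)))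
      map_add' := fun e f ↦ by
        simp only [Preadditive.add_comp, Preadditive.comp_add, Prod.mk_add_mk]
      map_smul' := fun n e ↦ by
        simp only [Preadditive.zsmul_comp, Preadditive.comp_zsmul, RingHom.id_apply,
          Prod.smul_mk] }
  have hc : Function.Injective c := by
    intro e f h
    simp only [c, LinearMap.coe_mk, AddHom.coe_mk, Prod.mk.injEq] at h
    obtain ⟨⟨h₁₁, h₁₂⟩, h₂₁, h₂₂⟩ := h
    refine biprod.hom_ext' _ _ (biprod.hom_ext _ _ ?_ ?_) (biprod.hom_ext _ _ ?_ ?_) <;>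
      simpa only [Category.assoc]
  exact Module.Finite.of_injective c hc

end AbelianVariety

/-! ## Assemblies: Tate's Main Theorem (`Hom` form) from the printed inputs at `A × B` -/

section Assembly

open AbelianVariety

variable {K : Type u} [Field K] (A B : AbelianVariety K) (ℓ : ℕ) [Fact ℓ.Prime]

/-- **Tate 1966, Main Theorem (`Hom` form), with the printed inputs on a product bicone.** For a
bicone `b` on `(A, B)` (e.g. `A ⊞ B`), the named fact `tate_bijective_of_finite A B ℓ` follows
from: injectivity of the Tate map (`hinj`, named fact `faltingsTateMap_injective A B`, Mumford §19
Thm. 3), finiteness of `K`-isomorphism classes in dimension `dim b.pt` (`hfin`, named fact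
`finite_isoClasses_of_finite`, Milne 1986 Cor. 18.9), quotients of `b.pt` by finite stable
`ℓ`-power subgroups (`hq`, named fact `exists_quotient_isogeny`), and `End⁰(b.pt)`
finite-dimensional (`hfd`, named fact `finiteDimensional_endAlgebra`) and semisimple (`hss`,
Poincaré–Mumford §19 Cor. 2 of Thm. 1) — `tate_bijective_of_finite_of_open_facts_bicone` with
`hss` from `isSemisimpleRing_rationalEndSubalgebra_of_endAlgebra` and the saturation input from
`saturated_span_tateModuleMap_of_divisible` and Milne's Lemma 12.6
(`exists_eq_nsmul_of_forall_smul_eq_zero`). [cite: Tate1966Endomorphisms, Main Theorem] -/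
theorem tate_bijective_of_finite_of_endAlgebra_bicone (b : BinaryBicone A B)
    (hinj : faltingsTateMap_injective A B) (hfin : finite_isoClasses_of_finite K b.pt.dim)
    (hq : exists_quotient_isogeny b.pt ℓ) (hfd : finiteDimensional_endAlgebra b.pt)
    (hss : IsSemisimpleRing (endAlgebra b.pt)) :
    tate_bijective_of_finite A B ℓ :=
  tate_bijective_of_finite_of_open_facts_bicone A B ℓ b hinj hfin hq
    (isSemisimpleRing_rationalEndSubalgebra_of_endAlgebra b.pt ℓ hfd hss) fun hℓ t d hd ht ↦
    saturated_span_tateModuleMap_of_divisible ℓ hℓ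
      (fun φ hφ ↦ exists_eq_nsmul_of_forall_smul_eq_zero ℓ hℓ φ hφ) t d hd ht

/-- **Tate 1966, Main Theorem (`Hom` form), with the printed inputs at `A ⊞ B`**: injectivity of
the Tate map `ℤ_ℓ ⊗ Hom_K(A, B) → Hom(T_ℓ A, T_ℓ B)` (Mumford §19 Thm. 3), finiteness of
`K`-isomorphism classes in dimension `dim (A ⊞ B)` (Milne 1986 Cor. 18.9), quotients of `A ⊞ B`
(Mumford §7 Thm. 4), `End⁰(A ⊞ B)` finite-dimensional (Mumford §19 Cor. 1 of Thm. 3) and semisimple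
(Poincaré, Mumford §19 Cor. 2 of Thm. 1) give `tate_bijective_of_finite A B ℓ`. This is the
intended shape of the discharge `tate_bijective_of_finite_holds`.
[cite: Tate1966Endomorphisms, Main Theorem] -/
theorem tate_bijective_of_finite_of_endAlgebra
    (hinj : faltingsTateMap_injective A B) (hfin : finite_isoClasses_of_finite K (A ⊞ B).dim)
    (hq : exists_quotient_isogeny (A ⊞ B) ℓ) (hfd : finiteDimensional_endAlgebra (A ⊞ B))
    (hss : IsSemisimpleRing (endAlgebra (A ⊞ B))) :
    tate_bijective_of_finite A B ℓ :=
  tate_bijective_of_finite_of_endAlgebra_bicone A B ℓ (BinaryBiproduct.bicone A B) hinj hfin hq hfd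
    hss

/-- The same with the two Mumford §19 Thm. 3 inputs — injectivity of the Tate map of
`Hom_K(A, B)` and finite-dimensionality of `End⁰(A ⊞ B)` — both supplied from finite generation of
`End_K(A ⊞ B)` (named fact `module_finite_hom (A ⊞ B) (A ⊞ B)`; `Hom_K(A, B)` is then finitely
generated as a direct summand, `module_finite_hom_of_module_finite_end_biprod`, so the Tate map is
injective by Milne 1986 Thm. 12.5, `faltingsTateMap_injective_of_module_finite_hom`; and
`finiteDimensional_endAlgebra_of_module_finite_hom`). [folklore] -/
theorem tate_bijective_of_finite_of_endAlgebra_of_module_finite_hom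
    (hfin : finite_isoClasses_of_finite K (A ⊞ B).dim) (hq : exists_quotient_isogeny (A ⊞ B) ℓ)
    (hss : IsSemisimpleRing (endAlgebra (A ⊞ B))) (hfg : module_finite_hom (A ⊞ B) (A ⊞ B)) :
    tate_bijective_of_finite A B ℓ :=
  tate_bijective_of_finite_of_endAlgebra A B ℓ
    (faltingsTateMap_injective_of_module_finite_hom A B
      (module_finite_hom_of_module_finite_end_biprod hfg))
    hfin hq (finiteDimensional_endAlgebra_of_module_finite_hom (A ⊞ B) hfg) hss

/-- **Tate 1966, Main Theorem (`Hom` form), with Poincaré's theorem in place of the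
semisimplicity of `End⁰(A ⊞ B)`**: as `tate_bijective_of_finite_of_endAlgebra`, with `hss`
supplied by `isSemisimpleRing_endAlgebra_of_isogeny_biprod` from "non-zero homomorphisms of
simple abelian varieties are isogenies" (`hsimple`, Mumford §19, proof of Cor. 2 of Thm. 1) and
Poincaré's complete reducibility theorem in splitting form (`hP`: a non-simple `X` receives an
isogeny from a biproduct of abelian varieties of smaller dimension; Mumford §19 Thm. 1 and Cor. 1,
p. 173; Milne 1986 Prop. 12.1). [cite: Tate1966Endomorphisms, Main Theorem] -/
theorem tate_bijective_of_finite_of_poincare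
    (hinj : faltingsTateMap_injective A B) (hfin : finite_isoClasses_of_finite K (A ⊞ B).dim)
    (hq : exists_quotient_isogeny (A ⊞ B) ℓ) (hfd : finiteDimensional_endAlgebra (A ⊞ B))
    (hsimple : ∀ (X Y : AbelianVariety K), IsSimple X → IsSimple Y →
      ∀ f : X ⟶ Y, f ≠ 0 → IsIsogeny f)
    (hP : ∀ X : AbelianVariety K, ¬ IsSimple X → ∃ X₁ X₂ : AbelianVariety K,
      X₁.dim < X.dim ∧ X₂.dim < X.dim ∧ ∃ σ : X₁ ⊞ X₂ ⟶ X, IsIsogeny σ) :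
    tate_bijective_of_finite A B ℓ :=
  tate_bijective_of_finite_of_endAlgebra A B ℓ hinj hfin hq hfd
    (isSemisimpleRing_endAlgebra_of_isogeny_biprod hsimple hP (A ⊞ B))

open scoped Classical in
/-- **Tate 1966, Main Theorem (`Hom` form), from Mumford's statements.**
`tate_bijective_of_finite A B ℓ` follows from the two finite-field inputs of Tate's proof —
finiteness of `K`-isomorphism classes in dimension `dim (A ⊞ B)` (`hfin`, Milne 1986 Cor. 18.9)
and quotients of `A ⊞ B` by finite stable subgroups (`hq`, Mumford §7 Thm. 4) — together with the
theory of Mumford §19 exactly as consumed by `module_finite_hom_of_mumford19`: `[n]_X` an isogeny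
(`h₀`, named fact `isIsogeny_zsmul_id`, §6 App. 2), Poincaré's complete reducibility theorem
(`hP1`, §19 Thm. 1), "non-zero homomorphisms of simple abelian varieties are isogenies"
(`hsimple`, §19 Cor. 2), the degree theorem for simple abelian varieties (`hdeg`, §19 Thm. 2) and
the torsion counts of `A` and `B` (`hA`, `hB`, named fact `natCard_torsionPoints_of_isAlgClosed`,
§6 Prop. p. 64). These give the four groups `Hom_K(X, Y)`, `X, Y ∈ {A, B}`, finitely generated
(`module_finite_hom_of_mumford19`), hence `End_K(A ⊞ B)` finitely generated
(`module_finite_end_biprod_of_corners`) and `End⁰(A ⊞ B)` semisimple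
(`isSemisimpleRing_endAlgebra_of_mumford19`); conclude by
`tate_bijective_of_finite_of_endAlgebra_of_module_finite_hom`.
[cite: Tate1966Endomorphisms, Main Theorem] -/
theorem tate_bijective_of_finite_of_mumford19
    (hfin : finite_isoClasses_of_finite K (A ⊞ B).dim) (hq : exists_quotient_isogeny (A ⊞ B) ℓ)
    (h₀ : ∀ X : AbelianVariety K, isIsogeny_zsmul_id X)
    (hP1 : ∀ (X Y : AbelianVariety K) (i : Y ⟶ X), IsClosedImmersion (Hom.toSchemeHom i) →
      0 < Y.dim → Y.dim < X.dim →
      ∃ (Z : AbelianVariety K) (j : Z ⟶ X), IsClosedImmersion (Hom.toSchemeHom j) ∧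
        IsIsogeny (biprod.desc i j))
    (hsimple : ∀ (X Y : AbelianVariety K), IsSimple X → IsSimple Y →
      ∀ f : X ⟶ Y, f ≠ 0 → IsIsogeny f)
    (hdeg : ∀ X : AbelianVariety K, IsSimple X → 0 < X.dim →
      ∀ (r : ℕ) (e : Fin r → (X ⟶ X)), ∃ F : MvPolynomial (Fin r) ℚ,
        (∀ (t : ℚ) (q : Fin r → ℚ), MvPolynomial.eval (t • q) F =
          t ^ (2 * X.dim) * MvPolynomial.eval q F) ∧
        ∀ n : Fin r → ℤ,
          ((if IsIsogeny (∑ i, n i • e i) then (Hom.kerRank (∑ i, n i • e i) : ℤ) else 0 : ℤ) : ℚ) =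
            MvPolynomial.eval (fun i => (n i : ℚ)) F)
    (hA : A.natCard_torsionPoints_of_isAlgClosed (AlgebraicClosure K))
    (hB : B.natCard_torsionPoints_of_isAlgClosed (AlgebraicClosure K)) :
    tate_bijective_of_finite A B ℓ :=
  have hfg : ∀ X Y : AbelianVariety K, X.natCard_torsionPoints_of_isAlgClosed (AlgebraicClosure K) →
      Y.natCard_torsionPoints_of_isAlgClosed (AlgebraicClosure K) → Module.Finite ℤ (X ⟶ Y) :=
    fun X Y hX hY ↦ module_finite_hom_of_mumford19 h₀ hP1 hsimple hdeg X Y hX hY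
  tate_bijective_of_finite_of_endAlgebra_of_module_finite_hom A B ℓ hfin hq
    (isSemisimpleRing_endAlgebra_of_mumford19 hP1 hsimple (A ⊞ B))
    (module_finite_end_biprod_of_corners (hfg A A hA hA) (hfg A B hA hB) (hfg B A hB hA)
      (hfg B B hB hB))

end Assembly

end Literature.AlgebraicGeometry.Motives
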